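import Literature.Geometry.Symplectic.JPlanePencilLocalFamilyProofs
import HarnessLib

/-!
# The cap of a pencil member at the base point: members close up to smooth spheres through `p`

Support theorems (no new definitions of notions beyond two explicit formulas, no named facts,
D-0026) for `Literature.Geometry.Symplectic.jPlanePencil_localFamily_homotopySphere`
(`JPlanePencilLocalFamily.lean`; C. Wendl, *Holomorphic Curves in Low Dimensions* (2018),
Prop. 2.53 with `m = 1`, for homotopy 4-spheres).

In Wendl's proof the members of the pencil are embedded `J`-holomorphic SPHERES `û : S² → X̂`
through the constraint point; in the plane form of the tree's statement a member is a proper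
`J`-holomorphic plane `u : ℂ → M ∖ {p}` converging to `p`. This file closes the member up INSIDE
THE COMPACT MANIFOLD `M` ITSELF: the **cap chart** `pencilCap p u : ℂ → M`, `η ↦ u (η⁻¹)`
(`η ≠ 0`), `0 ↦ p`, is a smooth immersed disc through `p`, so that `(u, pencilCap p u)` is a
smooth two-chart sphere in `M` in the sense of the tree's intersection-index theorem
`sphere_zeroSetIndex_factorsThroughHomology_of_isClosed` (smooth `u v : ℂ → M` with
`v z = u z⁻¹`). This is the test cycle for the homological count in the universality clause of
Prop. 2.53 (`m = 1`): in `M` (rather than in `X̂ = M ∖ {p} ∪ ℂP¹`) all members pass through the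
one point `p`, pairwise tangent there to the same real 2-plane, and `H₂(M; ℤ) = 0`.

* `capModel (X, W) = flatCx⁻¹ ((conj X, W · conj X) / (1 + |W|²))` — the recentred chart position
  of the point with compactified coordinates `(X, W) = (1/z, w/z)`:
  `capModel (z⁻¹, w/z) = ι (flatCx⁻¹ (z, w))` (`capModel_eq_inversion`), smooth on `ℂ²`
  (`contDiff_capModel`), `capModel (0, W) = 0`.
* `extChartAt_sub_eq_inversion_pencilCoord` — `e x − e p = ι (flatCx⁻¹ (pencilCoord p x))`.
* `pencilCap p u`, `pencilCap_zero`, `pencilCap_of_ne_zero`;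
  `IsPencilPlane.exists_pencilCap_chart` — on a disc about `0`,
  `e (pencilCap p u η) = e p + capModel (X η, W η)` with the holomorphic compactified coordinates
  `X, W` of `IsPencilPlane.exists_differentiableOn_compactification` (`X(0) = W(0) = 0`,
  `X'(0) = 1`, `W'(0) = b`);
  `IsPencilPlane.contMDiff_pencilCap` — the cap chart is `C^∞` on `ℂ`;
  `IsPencilPlane.injective_mfderiv_pencilCap` — and immersed (at `0`: the chart expression has
  differential `η ↦ flatCx⁻¹ (conj η, 0)`);
  `IsPencilPlane.pencilCap_injective`, `IsPencilPlane.range_pencilCap` — it is injective with image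
  `u (ℂ ∖ 0) ∪ {p}`, and `p ∉ u (ℂ)`.

## References

* C. Wendl, *Holomorphic Curves in Low Dimensions*, LNM 2216, Springer (2018), Prop. 2.53 and its
  proof sketch (pp. 65–66). [Wendl2018]
* M. Gromov, *Pseudo holomorphic curves in symplectic manifolds*, Invent. Math. 82 (1985),
  §0.3.C (the inversion `ι`). [Gromov1985]
-/

noncomputable section

open scoped Manifold ContDiff Topology ComplexConjugate
open Set Function Filter Metric Complex

namespace Literature.Geometry.Symplectic

/-! ### §1 The cap model `capModel (X, W) = ι (flatCx⁻¹ (1/X, W/X))` -/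

section CapModel

/-- The recentred chart position of the point of `ℝ⁴ ∖ 0 = ℂ² ∖ 0` whose flat coordinates
`(z, w) = flatCx (ι y)` have compactified coordinates `X = 1/z`, `W = w/z`:
`capModel (X, W) = flatCx⁻¹ ((1 + |W|²)⁻¹ · (conj X, W · conj X))`. It is a polynomial expression
divided by a positive one, hence smooth on all of `ℂ²`, including the line `X = 0` (which is sent
to the base point `0`). [cite: Wendl2018, Prop. 2.53 (proof sketch, p. 65)] -/
def capModel (q : ℂ × ℂ) : EuclideanSpace ℝ (Fin 4) :=
  flatCx.symm ((1 + ‖q.2‖ ^ 2)⁻¹ • (conj q.1, q.2 * conj q.1))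

/-- Unfolding. [folklore] -/
theorem capModel_apply (X W : ℂ) :
    capModel (X, W) = flatCx.symm ((1 + ‖W‖ ^ 2)⁻¹ • (conj X, W * conj X)) := rfl

/-- The line at infinity `X = 0` is capped to the base point. [folklore] -/
@[simp] theorem capModel_zero_fst (W : ℂ) : capModel (0, W) = 0 := by
  simp [capModel]

/-- `capModel` is `C^∞` on `ℂ²`. [folklore] -/
theorem contDiff_capModel : ContDiff ℝ ∞ capModel := by
  unfold capModel
  refine flatCx.symm.contDiff.comp ?_
  have h1 : ContDiff ℝ ∞ fun q : ℂ × ℂ => (1 + ‖q.2‖ ^ 2)⁻¹ := by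
    refine ContDiff.inv (contDiff_const.add ((contDiff_norm_sq ℝ).comp contDiff_snd)) ?_
    intro q; positivity
  have h2 : ContDiff ℝ ∞ fun q : ℂ × ℂ => ((starRingEnd ℂ) q.1, q.2 * (starRingEnd ℂ) q.1) :=
    (Complex.conjCLE.contDiff.comp contDiff_fst).prodMk
      (contDiff_snd.mul (Complex.conjCLE.contDiff.comp contDiff_fst))
  exact h1.smul h2

/-- `‖flatCx⁻¹ (z, w)‖² = |z|² + |w|²`. [folklore] -/
theorem norm_sq_flatCx_symm (z w : ℂ) : ‖flatCx.symm (z, w)‖ ^ 2 = ‖z‖ ^ 2 + ‖w‖ ^ 2 := by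
  have h := norm_sq_flatCx_fst_add (flatCx.symm (z, w))
  simpa using h.symm

/-- **The cap model is the inversion in compactified coordinates**:
`capModel (z⁻¹, w/z) = ι (flatCx⁻¹ (z, w))` for `z ≠ 0`. [cite: Wendl2018, Prop. 2.53 (p. 65)] -/
theorem capModel_eq_inversion {z : ℂ} (hz : z ≠ 0) (w : ℂ) :
    capModel (z⁻¹, w / z) = inversion (flatCx.symm (z, w)) := by
  have hzn : (‖z‖ : ℝ) ≠ 0 := norm_ne_zero_iff.2 hz
  have hzC : ((‖z‖ : ℝ) : ℂ) ≠ 0 := Complex.ofReal_ne_zero.2 hzn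
  have hpos : 0 < ‖z‖ ^ 2 + ‖w‖ ^ 2 := by positivity
  have hposC : ((‖z‖ : ℝ) : ℂ) ^ 2 + ((‖w‖ : ℝ) : ℂ) ^ 2 ≠ 0 := by
    have : ((‖z‖ ^ 2 + ‖w‖ ^ 2 : ℝ) : ℂ) ≠ 0 := Complex.ofReal_ne_zero.2 hpos.ne'
    simpa using this
  have hzc : conj z = ((‖z‖ ^ 2 : ℝ) : ℂ) / z := by
    rw [eq_div_iff hz, ← Complex.normSq_eq_norm_sq, ← Complex.mul_conj, mul_comm]
  rw [inversion, norm_sq_flatCx_symm, ← ContinuousLinearEquiv.map_smul, capModel_apply]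
  congr 1
  have h1 : (1 + ‖w / z‖ ^ 2)⁻¹ = ‖z‖ ^ 2 * (‖z‖ ^ 2 + ‖w‖ ^ 2)⁻¹ := by
    rw [norm_div]
    field_simp
  ext1
  · simp only [Prod.smul_fst, Complex.real_smul, h1, map_inv₀, hzc]
    push_cast
    field_simp
  · simp only [Prod.smul_snd, Complex.real_smul, h1, map_inv₀, hzc]
    push_cast
    field_simp

end CapModel

/-! ### §2 The cap chart `pencilCap p u : η ↦ u (η⁻¹)`, `0 ↦ p` -/

section Cap

variable {M : Type*} [TopologicalSpace M] [T2Space M]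

/-- The **cap chart** of a plane `u : ℂ → M ∖ {p}` at the base point: `η ↦ u (η⁻¹)` for `η ≠ 0`
and `0 ↦ p`. For a pencil member this is the second chart `v` (`v z = u z⁻¹`) of the closed-up
sphere `u(ℂ) ∪ {p} ⊂ M`. [cite: Wendl2018, Prop. 2.53 (proof sketch, p. 65)] -/
def pencilCap (p : M) (u : ℂ → punctured p) (η : ℂ) : M :=
  if η = 0 then p else (u η⁻¹).1

section Basic

variable {p : M} {u : ℂ → punctured p}

/-- The cap chart sends `0` to the base point. [folklore] -/
@[simp] theorem pencilCap_zero : pencilCap p u 0 = p := by simp [pencilCap]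

/-- Off `0` the cap chart is `u (η⁻¹)`. [folklore] -/
theorem pencilCap_of_ne_zero {η : ℂ} (hη : η ≠ 0) : pencilCap p u η = (u η⁻¹).1 := by
  simp [pencilCap, hη]

/-- `pencilCap p u (ξ⁻¹) = u ξ` for `ξ ≠ 0`: the two charts agree on `ℂ ∖ 0`. [folklore] -/
theorem pencilCap_inv {ξ : ℂ} (hξ : ξ ≠ 0) : pencilCap p u ξ⁻¹ = (u ξ).1 := by
  rw [pencilCap_of_ne_zero (inv_ne_zero hξ), inv_inv]

/-- The cap chart away from `0` is `val ∘ u ∘ (·)⁻¹` near every `η ≠ 0`. [folklore] -/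
theorem pencilCap_eventuallyEq {η : ℂ} (hη : η ≠ 0) :
    pencilCap p u =ᶠ[𝓝 η] fun η' => (u η'⁻¹).1 := by
  filter_upwards [eventually_ne_nhds hη] with η' hη'
  exact pencilCap_of_ne_zero hη'

/-- The cap chart takes the value `p` only at `0` (`p` is not a value of `u`). [folklore] -/
theorem pencilCap_eq_base_iff {η : ℂ} : pencilCap p u η = p ↔ η = 0 := by
  refine ⟨fun h => ?_, fun h => by simp [h]⟩
  by_contra hη
  rw [pencilCap_of_ne_zero hη] at h
  exact (mem_punctured.1 (u η⁻¹).2) h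

end Basic

variable [ChartedSpace (EuclideanSpace ℝ (Fin 4)) M]

/-- **The recentred chart is the inversion of the flat coordinates**:
`e x − e p = ι (flatCx⁻¹ (pencilCoord p x))` (`ι` is an involution). [folklore] -/
theorem extChartAt_sub_eq_inversion_pencilCoord (p : M) (x : punctured p) :
    extChartAt (𝓡 4) p x.1 - extChartAt (𝓡 4) p p = inversion (flatCx.symm (pencilCoord p x)) := by
  rw [pencilCoord_eq_flatCx, ContinuousLinearEquiv.symm_apply_apply, inversion_inversion]

/-- The compactified coordinate `X = 1/z` along the cap chart (`0` at `η = 0`). [folklore] -/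
def capX (p : M) (u : ℂ → punctured p) (η : ℂ) : ℂ :=
  if η = 0 then 0 else ((pencilCoord p (u η⁻¹)).1)⁻¹

/-- The compactified coordinate `W = w/z` along the cap chart (`0` at `η = 0`). [folklore] -/
def capW (p : M) (u : ℂ → punctured p) (η : ℂ) : ℂ :=
  if η = 0 then 0 else (pencilCoord p (u η⁻¹)).2 / (pencilCoord p (u η⁻¹)).1

variable {p : M} {u : ℂ → punctured p}

/-- `X(0) = 0`. [folklore] -/
@[simp] theorem capX_zero : capX p u 0 = 0 := by simp [capX]

/-- `W(0) = 0`. [folklore] -/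
@[simp] theorem capW_zero : capW p u 0 = 0 := by simp [capW]

/-- `X(η) = 1 / z (u (η⁻¹))` for `η ≠ 0`. [folklore] -/
theorem capX_of_ne_zero {η : ℂ} (hη : η ≠ 0) : capX p u η = ((pencilCoord p (u η⁻¹)).1)⁻¹ := by
  simp [capX, hη]

/-- `W(η) = w / z` at `u (η⁻¹)` for `η ≠ 0`. [folklore] -/
theorem capW_of_ne_zero {η : ℂ} (hη : η ≠ 0) :
    capW p u η = (pencilCoord p (u η⁻¹)).2 / (pencilCoord p (u η⁻¹)).1 := by
  simp [capW, hη]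

/-- `capX` as the `if`-expression of `IsPencilPlane.exists_differentiableOn_compactification`.
[folklore] -/
theorem capX_eq : capX p u = fun η => if η = 0 then (0 : ℂ) else ((pencilCoord p (u η⁻¹)).1)⁻¹ := rfl

/-- `capW` as the `if`-expression of `IsPencilPlane.exists_differentiableOn_compactification`.
[folklore] -/
theorem capW_eq : capW p u =
    fun η => if η = 0 then (0 : ℂ) else (pencilCoord p (u η⁻¹)).2 / (pencilCoord p (u η⁻¹)).1 := rfl

/-- **Chart formula for the cap.** Wherever `z (u (η⁻¹)) ≠ 0` (and at `η = 0`),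
`e (pencilCap p u η) = e p + capModel (X η, W η)`. [cite: Wendl2018, Prop. 2.53 (p. 65)] -/
theorem extChartAt_pencilCap {η : ℂ} (hz : η ≠ 0 → (pencilCoord p (u η⁻¹)).1 ≠ 0) :
    extChartAt (𝓡 4) p (pencilCap p u η) =
      extChartAt (𝓡 4) p p + capModel (capX p u η, capW p u η) := by
  rcases eq_or_ne η 0 with rfl | hη
  · simp
  · rw [capX_of_ne_zero hη, capW_of_ne_zero hη, capModel_eq_inversion (hz hη), Prod.mk.eta,
      ← extChartAt_sub_eq_inversion_pencilCoord, pencilCap_of_ne_zero hη]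
    abel

end Cap

/-! ### §3 Smoothness and immersion of the cap of a pencil member -/

namespace IsPencilPlane

variable {M : Type*} [TopologicalSpace M] [T2Space M] [SecondCountableTopology M] [CompactSpace M]
  [ChartedSpace (EuclideanSpace ℝ (Fin 4)) M] [IsManifold (𝓡 4) ∞ M]
  {p : M} {J : ∀ x : punctured p, TangentSpace (𝓡 4) x →L[ℝ] TangentSpace (𝓡 4) x}
  {u : ℂ → punctured p} {b : ℂ} {ε : ℝ}

omit [SecondCountableTopology M] [IsManifold (𝓡 4) ∞ M] in
/-- **A cap radius.** For a member there is `r > 0` such that for `0 < |η| < r` the point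
`u (η⁻¹)` lies in the punctured `ε`-chart-ball with `z (u (η⁻¹)) ≠ 0` (indeed `|z| > 1`).
[cite: Wendl2018, Prop. 2.53 (m = 1)] -/
theorem exists_cap_radius (h : IsPencilPlane J u b) (hε : 0 < ε) :
    ∃ r : ℝ, 0 < r ∧ ∀ η : ℂ, η ≠ 0 → ‖η‖ < r →
      InPuncturedChartBall p ε (u η⁻¹) ∧ 1 < ‖(pencilCoord p (u η⁻¹)).1‖ := by
  obtain ⟨R₀, hR₀⟩ := h.exists_forall_norm_le_inPuncturedChartBall hε
  obtain ⟨R₁, hR₁⟩ := exists_forall_norm_le_of_eventually_cocompact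
    (h.tendsto_norm_fst.eventually_gt_atTop 1)
  set T : ℝ := max (max R₀ R₁) 1 with hT
  have hTpos : 0 < T := lt_of_lt_of_le one_pos (le_max_right _ _)
  refine ⟨T⁻¹, inv_pos.2 hTpos, fun η hη0 hη => ?_⟩
  have hηinv : T < ‖η⁻¹‖ := by
    rw [norm_inv]; rwa [lt_inv_comm₀ hTpos (norm_pos_iff.2 hη0)]
  exact ⟨hR₀ _ (le_trans (le_trans (le_max_left _ _) (le_max_left _ _)) hηinv.le),
    hR₁ _ (le_trans (le_trans (le_max_right _ _) (le_max_left _ _)) hηinv.le)⟩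

omit [SecondCountableTopology M] [CompactSpace M] [IsManifold (𝓡 4) ∞ M] in
/-- The cap chart of a member is injective (`u` is injective and misses `p`). [folklore] -/
theorem pencilCap_injective (h : IsPencilPlane J u b) : Injective (pencilCap p u) := by
  intro η₁ η₂ hη
  rcases eq_or_ne η₁ 0 with rfl | h₁
  · exact (pencilCap_eq_base_iff.1 (by simpa using hη.symm)).symm
  rcases eq_or_ne η₂ 0 with rfl | h₂
  · exact pencilCap_eq_base_iff.1 (by simpa using hη)
  rw [pencilCap_of_ne_zero h₁, pencilCap_of_ne_zero h₂] at hη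
  exact inv_injective (h.injective (Subtype.ext hη))

omit [SecondCountableTopology M] in
/-- **The cap chart of a member is smooth**, also at `η = 0`: on a cap disc it is
`e⁻¹ (e p + capModel (X, W))` with `X, W` holomorphic
(`IsPencilPlane.exists_differentiableOn_compactification`), elsewhere it is `u ∘ (·)⁻¹`.
[cite: Wendl2018, Prop. 2.53 (proof sketch, p. 65: the member closes up to a smooth sphere)] -/
theorem contMDiff_pencilCap (h : IsPencilPlane J u b) (hε : 0 < ε)
    (hJstd : ∀ x : punctured p, InPuncturedChartBall p ε x →
      ∀ (v : TangentSpace (𝓡 4) x) (c : EuclideanSpace ℝ (Fin 4)),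
        inner ℝ (fderiv ℝ inversion (extChartAt (𝓡 4) p x.1 - extChartAt (𝓡 4) p p)
          (mfderiv (𝓡 4) 𝓘(ℝ, EuclideanSpace ℝ (Fin 4))
            (fun z : punctured p => extChartAt (𝓡 4) p z.1) x (J x v))) c
        = stdSymplecticForm (fderiv ℝ inversion (extChartAt (𝓡 4) p x.1 - extChartAt (𝓡 4) p p)
          (mfderiv (𝓡 4) 𝓘(ℝ, EuclideanSpace ℝ (Fin 4))
            (fun z : punctured p => extChartAt (𝓡 4) p z.1) x v)) c) :
    ContMDiff 𝓘(ℝ, ℂ) (𝓡 4) ∞ (pencilCap p u) := by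
  obtain ⟨r₁, hr₁, hball⟩ := h.exists_cap_radius hε
  obtain ⟨r₂, hr₂, hX, hW⟩ := h.exists_differentiableOn_compactification hε hJstd
  set r : ℝ := min r₁ r₂ with hr_def
  have hr : 0 < r := lt_min hr₁ hr₂
  -- the chart expression `g = e p + capModel (X, W)` is smooth on the cap disc
  have hXr : ContDiffOn ℝ ∞ (capX p u) (ball 0 r) :=
    ((hX.mono (ball_subset_ball (min_le_right _ _))).contDiffOn isOpen_ball).restrict_scalars ℝ
  have hWr : ContDiffOn ℝ ∞ (capW p u) (ball 0 r) :=
    ((hW.mono (ball_subset_ball (min_le_right _ _))).contDiffOn isOpen_ball).restrict_scalars ℝ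
  have hg : ContDiffOn ℝ ∞
      (fun η' => extChartAt (𝓡 4) p p + capModel (capX p u η', capW p u η')) (ball 0 r) :=
    contDiffOn_const.add (contDiff_capModel.comp_contDiffOn (hXr.prodMk hWr))
  -- on the cap disc the cap chart stays in the chart source, with `z ≠ 0`
  have hz : ∀ η' ∈ ball (0 : ℂ) r, η' ≠ 0 → (pencilCoord p (u η'⁻¹)).1 ≠ 0 := by
    intro η' hη' h0
    have h1 := (hball η' h0 (lt_of_lt_of_le (mem_ball_zero_iff.1 hη') (min_le_left _ _))).2
    exact norm_pos_iff.1 (lt_trans one_pos h1)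
  have hsrc : ∀ η' ∈ ball (0 : ℂ) r,
      pencilCap p u η' ∈ (chartAt (EuclideanSpace ℝ (Fin 4)) p).source := by
    intro η' hη'
    rcases eq_or_ne η' 0 with rfl | h0
    · simp
    · rw [pencilCap_of_ne_zero h0]
      exact (hball η' h0 (lt_of_lt_of_le (mem_ball_zero_iff.1 hη') (min_le_left _ _))).1.1
  have heq : ∀ η' ∈ ball (0 : ℂ) r, pencilCap p u η' =
      ((extChartAt (𝓡 4) p).symm ∘
        fun η' => extChartAt (𝓡 4) p p + capModel (capX p u η', capW p u η')) η' := by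
    intro η' hη'
    rw [Function.comp_apply, ← extChartAt_pencilCap (hz η' hη'),
      (extChartAt (𝓡 4) p).left_inv (by rw [extChartAt_source]; exact hsrc η' hη')]
  have hmaps : MapsTo (fun η' => extChartAt (𝓡 4) p p + capModel (capX p u η', capW p u η'))
      (ball 0 r) (extChartAt (𝓡 4) p).target := by
    intro η' hη'
    show extChartAt (𝓡 4) p p + capModel (capX p u η', capW p u η') ∈ (extChartAt (𝓡 4) p).target
    rw [← extChartAt_pencilCap (hz η' hη')]
    exact (extChartAt (𝓡 4) p).map_source (by rw [extChartAt_source]; exact hsrc η' hη')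
  have hcap : ContMDiffOn 𝓘(ℝ, ℂ) (𝓡 4) ∞ (pencilCap p u) (ball 0 r) :=
    (((contMDiffOn_extChartAt_symm (I := 𝓡 4) p).comp hg.contMDiffOn hmaps).congr heq)
  intro η
  by_cases hη : ‖η‖ < r
  · exact hcap.contMDiffAt (isOpen_ball.mem_nhds (by simpa using hη))
  · have hη0 : η ≠ 0 := by
      rintro rfl; exact hη (by simpa using hr)
    have h1 : ContMDiffAt 𝓘(ℝ, ℂ) 𝓘(ℝ, ℂ) ∞ (fun η' : ℂ => η'⁻¹) η :=
      ((contDiffAt_inv ℂ hη0).restrict_scalars ℝ).contMDiffAt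
    have h2 : ContMDiffAt 𝓘(ℝ, ℂ) (𝓡 4) ∞ (fun η' : ℂ => (u η'⁻¹).1) η :=
      (contMDiff_subtype_val.comp h.contMDiff).contMDiffAt.comp η h1
    exact h2.congr_of_eventuallyEq (pencilCap_eventuallyEq hη0)

omit [SecondCountableTopology M] in
/-- The cap chart of a member is continuous. [folklore] -/
theorem continuous_pencilCap (h : IsPencilPlane J u b) (hε : 0 < ε)
    (hJstd : ∀ x : punctured p, InPuncturedChartBall p ε x →
      ∀ (v : TangentSpace (𝓡 4) x) (c : EuclideanSpace ℝ (Fin 4)),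
        inner ℝ (fderiv ℝ inversion (extChartAt (𝓡 4) p x.1 - extChartAt (𝓡 4) p p)
          (mfderiv (𝓡 4) 𝓘(ℝ, EuclideanSpace ℝ (Fin 4))
            (fun z : punctured p => extChartAt (𝓡 4) p z.1) x (J x v))) c
        = stdSymplecticForm (fderiv ℝ inversion (extChartAt (𝓡 4) p x.1 - extChartAt (𝓡 4) p p)
          (mfderiv (𝓡 4) 𝓘(ℝ, EuclideanSpace ℝ (Fin 4))
            (fun z : punctured p => extChartAt (𝓡 4) p z.1) x v)) c) :
    Continuous (pencilCap p u) :=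
  (h.contMDiff_pencilCap hε hJstd).continuous

omit [SecondCountableTopology M] [CompactSpace M] [IsManifold (𝓡 4) ∞ M] in
/-- **The cap chart is immersed away from `0`**: there it is `u ∘ (·)⁻¹` and `u` is immersed.
[folklore] -/
theorem injective_mfderiv_pencilCap_of_ne_zero (h : IsPencilPlane J u b) {η : ℂ} (hη : η ≠ 0) :
    Injective (mfderiv 𝓘(ℝ, ℂ) (𝓡 4) (pencilCap p u) η) := by
  -- the derivative of `η ↦ η⁻¹` at `η ≠ 0`, as a real-linear map
  set L : ℂ →L[ℝ] ℂ :=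
    ((ContinuousLinearMap.smulRight (1 : ℂ →L[ℂ] ℂ) (-(η ^ 2)⁻¹)).restrictScalars ℝ) with hL
  have hinv : HasMFDerivAt 𝓘(ℝ, ℂ) 𝓘(ℝ, ℂ) (fun η' : ℂ => η'⁻¹) η L :=
    ((hasDerivAt_inv hη).hasFDerivAt.restrictScalars ℝ).hasMFDerivAt
  have hcomp : HasMFDerivAt 𝓘(ℝ, ℂ) (𝓡 4) (fun η' : ℂ => (u η'⁻¹).1) η
      ((ContinuousLinearMap.id ℝ (EuclideanSpace ℝ (Fin 4))).comp
        ((mfderiv 𝓘(ℝ, ℂ) (𝓡 4) u η⁻¹).comp L)) :=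
    (Literature.Geometry.Manifold.OpenSubmanifold.hasMFDerivAt_subtype_val (u η⁻¹)).comp η
      ((h.mdifferentiableAt η⁻¹).hasMFDerivAt.comp η hinv)
  rw [(hcomp.congr_of_eventuallyEq (pencilCap_eventuallyEq hη)).mfderiv]
  have hLinj : Injective L := by
    intro v₁ v₂ hv
    have hc : (-(η ^ 2)⁻¹ : ℂ) ≠ 0 := neg_ne_zero.2 (inv_ne_zero (pow_ne_zero 2 hη))
    have h3 : v₁ * (-(η ^ 2)⁻¹) = v₂ * (-(η ^ 2)⁻¹) := by
      simpa [hL] using hv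
    exact mul_right_cancel₀ hc h3
  intro v₁ v₂ hv
  exact hLinj (h.injective_mfderiv η⁻¹ hv)

omit [SecondCountableTopology M] in
/-- **The cap chart is immersed at `0`.** The first flat coordinate of the chart expression,
`(1 + |W|²)⁻¹ · conj X`, has real differential `η ↦ conj η` at `0` (`X(0) = 0`, `X'(0) = 1`),
which is injective; hence so is `d(pencilCap p u)(0)`. [cite: Wendl2018, Prop. 2.53 (p. 65)] -/
theorem injective_mfderiv_pencilCap_zero (h : IsPencilPlane J u b) (hε : 0 < ε)
    (hJstd : ∀ x : punctured p, InPuncturedChartBall p ε x →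
      ∀ (v : TangentSpace (𝓡 4) x) (c : EuclideanSpace ℝ (Fin 4)),
        inner ℝ (fderiv ℝ inversion (extChartAt (𝓡 4) p x.1 - extChartAt (𝓡 4) p p)
          (mfderiv (𝓡 4) 𝓘(ℝ, EuclideanSpace ℝ (Fin 4))
            (fun z : punctured p => extChartAt (𝓡 4) p z.1) x (J x v))) c
        = stdSymplecticForm (fderiv ℝ inversion (extChartAt (𝓡 4) p x.1 - extChartAt (𝓡 4) p p)
          (mfderiv (𝓡 4) 𝓘(ℝ, EuclideanSpace ℝ (Fin 4))
            (fun z : punctured p => extChartAt (𝓡 4) p z.1) x v)) c) :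
    Injective (mfderiv 𝓘(ℝ, ℂ) (𝓡 4) (pencilCap p u) 0) := by
  obtain ⟨r₁, hr₁, hball⟩ := h.exists_cap_radius hε
  have hXd : HasDerivAt (capX p u) 1 0 := by rw [capX_eq]; exact h.hasDerivAt_inv_fst_zero
  have hWd : HasDerivAt (capW p u) b 0 := by rw [capW_eq]; exact h.hasDerivAt_snd_div_fst_zero
  -- `k η' := (1 + ‖W η'‖²)⁻¹ • conj (X η')` and its derivative at `0`
  set φ : ℂ → ℝ := fun η' => (1 + ‖capW p u η'‖ ^ 2)⁻¹ with hφ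
  set f : ℂ → ℂ := fun η' => (starRingEnd ℂ) (capX p u η') with hf
  have hφd : DifferentiableAt ℝ φ 0 := by
    have h1 : DifferentiableAt ℝ (fun η' => 1 + ‖capW p u η'‖ ^ 2) 0 :=
      (differentiableAt_const _).add ((hWd.differentiableAt.restrictScalars ℝ).norm_sq ℝ)
    exact h1.inv (by positivity)
  set f' : ℂ →L[ℝ] ℂ := (Complex.conjCLE : ℂ →L[ℝ] ℂ).comp
      ((ContinuousLinearMap.smulRight (1 : ℂ →L[ℂ] ℂ) (1 : ℂ)).restrictScalars ℝ) with hf'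
  have hfd : HasFDerivAt f f' 0 :=
    Complex.conjCLE.hasFDerivAt.comp 0 (hXd.hasFDerivAt.restrictScalars ℝ)
  set T : ℂ →L[ℝ] ℂ := (φ 0) • f' + (fderiv ℝ φ 0).smulRight (f 0) with hT
  have hk : HasFDerivAt (fun η' => φ η' • f η') T 0 := hφd.hasFDerivAt.smul hfd
  have hf0 : f 0 = 0 := by simp [hf]
  have hφ0 : φ 0 = 1 := by simp [hφ]
  -- on the cap disc, `k` is the first flat coordinate of the recentred chart expression
  have hz : ∀ η' ∈ ball (0 : ℂ) r₁, η' ≠ 0 → (pencilCoord p (u η'⁻¹)).1 ≠ 0 := by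
    intro η' hη' h0
    exact norm_pos_iff.1 (lt_trans one_pos (hball η' h0 (mem_ball_zero_iff.1 hη')).2)
  have hEq : (fun η' => (flatCx (extChartAt (𝓡 4) p (pencilCap p u η') -
      extChartAt (𝓡 4) p p)).1) =ᶠ[𝓝 0] fun η' => φ η' • f η' := by
    filter_upwards [isOpen_ball.mem_nhds (mem_ball_self hr₁)] with η' hη'
    rw [extChartAt_pencilCap (hz η' hη'), add_sub_cancel_left, capModel_apply,
      ContinuousLinearEquiv.apply_symm_apply, Prod.smul_fst]
  -- the chart expression and its derivative from the manifold chain rule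
  have hcap : MDifferentiableAt 𝓘(ℝ, ℂ) (𝓡 4) (pencilCap p u) 0 :=
    (h.contMDiff_pencilCap hε hJstd 0).mdifferentiableAt (by simp)
  have hsrc : pencilCap p u 0 ∈ (chartAt (EuclideanSpace ℝ (Fin 4)) p).source := by simp
  have hF : HasMFDerivAt 𝓘(ℝ, ℂ) 𝓘(ℝ, EuclideanSpace ℝ (Fin 4))
      (fun η' => extChartAt (𝓡 4) p (pencilCap p u η')) 0
      ((mfderiv (𝓡 4) 𝓘(ℝ, EuclideanSpace ℝ (Fin 4)) (extChartAt (𝓡 4) p) (pencilCap p u 0)).comp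
        (mfderiv 𝓘(ℝ, ℂ) (𝓡 4) (pencilCap p u) 0)) :=
    (hasMFDerivAt_extChartAt (I := 𝓡 4) hsrc).comp 0 hcap.hasMFDerivAt
  set D : ℂ →L[ℝ] EuclideanSpace ℝ (Fin 4) :=
    (mfderiv (𝓡 4) 𝓘(ℝ, EuclideanSpace ℝ (Fin 4)) (extChartAt (𝓡 4) p) (pencilCap p u 0)).comp
      (mfderiv 𝓘(ℝ, ℂ) (𝓡 4) (pencilCap p u) 0) with hD
  have hF' : HasFDerivAt (fun η' => extChartAt (𝓡 4) p (pencilCap p u η')) D 0 := hF.hasFDerivAt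
  set Lf : EuclideanSpace ℝ (Fin 4) →L[ℝ] ℂ :=
    (ContinuousLinearMap.fst ℝ ℂ ℂ).comp (flatCx : EuclideanSpace ℝ (Fin 4) →L[ℝ] ℂ × ℂ) with hLf
  have hG : HasFDerivAt (fun η' => (flatCx (extChartAt (𝓡 4) p (pencilCap p u η') -
      extChartAt (𝓡 4) p p)).1) (Lf.comp D) 0 :=
    Lf.hasFDerivAt.comp 0 (hF'.sub_const (extChartAt (𝓡 4) p p))
  have huniq : Lf.comp D = T := hG.unique (hk.congr_of_eventuallyEq hEq)
  -- conclude: `Lf ∘ De ∘ Dcap = 1 • f' + 0` is injective since `f' v = conj v` is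
  have hinjT : Injective T := by
    intro v₁ v₂ hv
    have h2 : f' v₁ = f' v₂ := by simpa [hT, hf0, hφ0] using hv
    exact (starRingEnd ℂ).injective (by simpa [hf'] using h2)
  have hinjD : Injective D := by
    have h' : Injective (⇑Lf ∘ ⇑D) := by
      rw [← huniq] at hinjT
      exact hinjT
    exact h'.of_comp
  have hcomp : Injective
      (⇑(mfderiv (𝓡 4) 𝓘(ℝ, EuclideanSpace ℝ (Fin 4)) (extChartAt (𝓡 4) p) (pencilCap p u 0)) ∘
        ⇑(mfderiv 𝓘(ℝ, ℂ) (𝓡 4) (pencilCap p u) 0)) := hinjD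
  exact hcomp.of_comp

omit [SecondCountableTopology M] in
/-- **The cap chart of a member is an immersion.** [cite: Wendl2018, Prop. 2.53 (p. 65)] -/
theorem injective_mfderiv_pencilCap (h : IsPencilPlane J u b) (hε : 0 < ε)
    (hJstd : ∀ x : punctured p, InPuncturedChartBall p ε x →
      ∀ (v : TangentSpace (𝓡 4) x) (c : EuclideanSpace ℝ (Fin 4)),
        inner ℝ (fderiv ℝ inversion (extChartAt (𝓡 4) p x.1 - extChartAt (𝓡 4) p p)
          (mfderiv (𝓡 4) 𝓘(ℝ, EuclideanSpace ℝ (Fin 4))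
            (fun z : punctured p => extChartAt (𝓡 4) p z.1) x (J x v))) c
        = stdSymplecticForm (fderiv ℝ inversion (extChartAt (𝓡 4) p x.1 - extChartAt (𝓡 4) p p)
          (mfderiv (𝓡 4) 𝓘(ℝ, EuclideanSpace ℝ (Fin 4))
            (fun z : punctured p => extChartAt (𝓡 4) p z.1) x v)) c) (η : ℂ) :
    Injective (mfderiv 𝓘(ℝ, ℂ) (𝓡 4) (pencilCap p u) η) := by
  rcases eq_or_ne η 0 with rfl | hη
  · exact h.injective_mfderiv_pencilCap_zero hε hJstd
  · exact h.injective_mfderiv_pencilCap_of_ne_zero hη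

end IsPencilPlane

end Literature.Geometry.Symplectic
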